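import Summits.NavierStokesRegularity.NavierStokesRegularity.Theses.TypeICertificateLadder
import Summits.NavierStokesRegularity.NavierStokesRegularity.Theorems.TypeICertificateLadderRungZero

/-!
# Route TypeICertificateLadder — `RungZero`, route-typed form (item stmt-NavierStokesRegularity-2886)

Thin route-typed wrapper: the theorem
`Summit.NavierStokesRegularity.NavierStokesRegularity.Theorems.typeICertificateLadder_rungZero`
(`Theorems/TypeICertificateLadderRungZero.lean`, which imports no route file) states item
stmt-NavierStokesRegularity-2886 verbatim; here it is re-typed as the route decl
`Theses.TypeICertificateLadder.RungZero` (Leray 1934, §19 (3.9): some positive collapse Reynolds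
number is excluded). CAVEAT for the materialiser (landing note on stmt-NavierStokesRegularity-13893):
this module imports the route file, so a `RungZero_holds` link should import the cycle-free module
`Theorems.TypeICertificateLadderRungZero` and use `typeICertificateLadder_rungZero` instead.
-/

namespace Summit.NavierStokesRegularity.NavierStokesRegularity.Theorems

/-- **Rung zero of the Type-I certificate ladder, route-typed** (item
stmt-NavierStokesRegularity-2886; Leray 1934, §19 (3.9)): `Theses.TypeICertificateLadder.RungZero`,
by the verbatim cycle-free theorem `typeICertificateLadder_rungZero` (`C := c/2`, `c` Leray's
constant of `leray_blowup_rate_top_holds`; sub-strip boundedness from Tao 2013, Cor. 11.1). -/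
theorem typeICertificateLadder_rungZero_proof :
    Summit.NavierStokesRegularity.NavierStokesRegularity.Theses.TypeICertificateLadder.RungZero := by
  unfold Summit.NavierStokesRegularity.NavierStokesRegularity.Theses.TypeICertificateLadder.RungZero
  exact typeICertificateLadder_rungZero

end Summit.NavierStokesRegularity.NavierStokesRegularity.Theorems
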